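import Summits.CriticalPhenomena.PercolationContinuityZ3.Theses.PercFiniteBoxLRO
import Summits.CriticalPhenomena.PercolationContinuityZ3.Theorems.PercFiniteBoxLRORenormaliseFromLinearLROBlockDefs
import Summits.CriticalPhenomena.PercolationContinuityZ3.Theorems.PercFiniteBoxLRORenormaliseFromLinearLROStubBlockLawInputs
import Summits.CriticalPhenomena.PercolationContinuityZ3.Theorems.PercFiniteBoxLRORenormaliseFromLinearLROStubDenseGlue
import Summits.CriticalPhenomena.PercolationContinuityZ3.Theorems.PercFiniteBoxLRORenormaliseFromLinearLROStubNoLROK1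
import Summits.CriticalPhenomena.PercolationContinuityZ3.Theorems.PercFiniteBoxLRORenormaliseFromLinearLROStubDenseMarkov
import Summits.CriticalPhenomena.PercolationContinuityZ3.Theorems.PercFiniteBoxLRORenormaliseFromLinearLROStubLargeCountMoments
import Summits.CriticalPhenomena.PercolationContinuityZ3.Theorems.PercFiniteBoxLRORenormaliseFromLinearLROAnatomy
import Summits.CriticalPhenomena.PercolationContinuityZ3.Theorems.PercFiniteBoxLRORenormaliseFromLinearLRONoGoodBoxAtPc
import Literature.Probability.Percolation.UniformPercolation
import Literature.Probability.Percolation.CriticalContinuityProofs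

/-!
# Crux `PercFiniteBoxLRO.RenormaliseFromLinearLRO` (stmt-CriticalPhenomena-0857), line `registered`, reshape 2 —
# the SAME-`p` DENSE-BLOCK CRITERION, no dense blocks at `p_c`, the near-maximal regime, and the composition

The assembled, unconditional output of reshape 2 of the line (lead c1, 2026-08-17), over the landed stubs
`stub_blockLawInputs` (p157445), `stub_denseGlue` (p158137), `stub_denseLocal` (p156138), `stub_noLRO_K1`
(p158904), `stub_denseMarkov` (p160841):

* `denseCriterion` — for every `K ≥ 2` there is `δ(K) > 0` with: for all `p ∈ [0,1]`, `s`, `m ≥ 1`,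
  `P_p(denseBox K s m) > 1 − δ ⇒ θ_{ℤ³}(p) > 0`.  A same-`p` finite-size criterion for percolation whose block event
  has NO in-box uniqueness clause (dense neighbouring blocks glue by pigeonhole); DST dependent percolation on the
  planar coarse lattice (PROVED in the tree) + union bound + `θ_x = θ_0`.
* `real_denseBox_criticalProbI_le` (registered sub-goal `stub_noDenseBoxAtPc`) — hence, unconditionally,
  `P_{p_c}(denseBox K s m) ≤ 1 − δ(K)` for all `s`, `m ≥ 1` (continuity of the box polynomial, `θ ≡ 0` below `p_c`).
* `not_nearMaximal_linearLRO_criticalProbI` (registered sub-goal `stub_noNearMaximalLRO`) — **the near-maximal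
  regime of the crux, PROVED**: for every `K ≥ 2` there is `η₀(K) > 0` such that linear-scale finite-box long-range
  order at `p_c(ℤ³)` with constants `(ρ, K)` is impossible once `ρ ≥ (1 − η₀)·θ(p_c)²` (second-moment boost
  `stub_denseMarkov` at a local scale `s` with `θ_s ≈ θ(p_c)`, then the previous item).
* `lro_le_theta_sq` — the LRO constant of `LRO_lin(p)` is at most `θ(p)²` (far points are joined only if both are
  locally large — independent events), so the near-maximal regime is the regime `ρ ∈ [(1−η₀)θ², θ²]`.
* `not_linearLRO_criticalProbI_of_critDense`, `renormaliseFromLinearLRO_of_critDense` — the composition: the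
  crux BY NAME from the one remaining open statement of the line (`stub_critDense`: `LRO_lin(p_c)` with `K ≥ 2`
  forces a dense block w.h.p. at some scale), the cases `K = 0` (vacuous) and `K = 1` (Barsky–Grimmett–Newman,
  `stub_noLRO_K1`) being settled.

Lands `--supports stmt-CriticalPhenomena-0857`.
-/

noncomputable section

namespace Summit.CriticalPhenomena.PercolationContinuityZ3.Theorems.RenormaliseFromLinearLRO

open Literature.Probability.Percolation Literature.Probability.LatticeModels
open MeasureTheory Filter Topology

/-- Measurability of the dense block (from its locality, Stub L). -/
theorem measurableSet_denseBox {K s m : ℕ} (hK : 2 ≤ K) (hm : 1 ≤ m) :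
    MeasurableSet (denseBox K s m) :=
  (stub_denseLocal K s m hK hm).measurableSet_of_finset

/-- `q ↦ P_q(denseBox K s m)` is continuous on `[0,1]` (a polynomial in `q`; from Stub L). -/
theorem continuous_real_denseBox {K s m : ℕ} (hK : 2 ≤ K) (hm : 1 ≤ m) :
    Continuous fun q : unitInterval => (bondPercolation (zdGraph 3) q).real (denseBox K s m) :=
  continuous_bondPercolation_real_of_isLocalEvent (zdGraph 3) ⟨_, stub_denseLocal K s m hK hm⟩

/-- **The same-`p` DENSE-BLOCK criterion**: for every `K ≥ 2` there is `δ > 0` such that for every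
`p ∈ [0,1]`, `s`, and `m ≥ 1`, `P_p(denseBox K s m) > 1 − δ ⇒ θ_{ℤ³}(p) > 0`.  Proof: `δ := η(2K+1)/2` with
`η` from the PROVED dependent-percolation theorem
`DuminilCopinSidoraviciusTassion2016_dependentPercolation_holds`; the coarse law of dense blocks is
`(2K+1)`-dependent and has edge densities `≥ 2 P_p(dense) − 1 > 1 − η` (Stub I with `R = Kn`, `D = 2K+1`,
`2Kn < (2K+1)n`), hence percolates from `0`; pull back through `blockCfg` and glue (Stub G): some
`x ∈ Λ(Kn)` percolates with positive probability; union bound over `Λ(Kn)` and `θ_x = θ_0`. -/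
theorem denseCriterion (K : ℕ) (hK : 2 ≤ K) :
    ∃ δ : ℝ, 0 < δ ∧ ∀ (p : unitInterval) (s m : ℕ), 1 ≤ m →
      1 - δ < (bondPercolation (zdGraph 3) p).real (denseBox K s m) → 0 < theta (zdGraph 3) 0 p := by
  obtain ⟨η, hη, hD⟩ := DuminilCopinSidoraviciusTassion2016_dependentPercolation_holds (2 * K + 1)
  refine ⟨η / 2, half_pos hη, ?_⟩
  intro p s m hm hgood
  set n : ℕ := (2 * s + 1) * m with hn
  have hn1 : 1 ≤ n := by rw [hn]; exact Nat.mul_pos (Nat.succ_pos _) hm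
  have hE : MeasurableSet (denseBox K s m) := measurableSet_denseBox hK hm
  haveI := isProbabilityMeasure_blockLaw n hE p
  -- (1) the coarse law is a (2K+1)-dependent bond percolation on ℤ² with densities ≥ 1 - η: it percolates
  have hdep := stub_blockLawInputs.1 p n (K * n) (2 * K + 1) (denseBox K s m) (by nlinarith) hE
    (stub_denseLocal K s m hK hm)
  have hdens : ∀ e ∈ (zdGraph 2).edgeSet, 1 - η ≤ (blockLaw n (denseBox K s m) p).real {σ | e ∈ σ} := by
    intro e he
    have h := stub_blockLawInputs.2 p n (denseBox K s m) hE e he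
    linarith
  have hperc : 0 < (blockLaw n (denseBox K s m) p).real (percolatesAt (0 : Site 2)) :=
    hD (blockLaw n (denseBox K s m) p) (fun F₁ F₂ hfar A B hA hB hAm hBm =>
      hdep F₁ F₂ (by exact_mod_cast hfar) A B hA hB hAm hBm) hdens
  -- (2) pull back to ℤ³ and glue (deterministically, Stub G)
  simp only [blockLaw] at hperc
  rw [map_measureReal_apply (measurable_blockCfg n hE) (measurableSet_percolatesAt_holds (0 : Site 2))]
    at hperc
  have hle : (bondPercolation (zdGraph 3) p).real (blockCfg n (denseBox K s m) ⁻¹' percolatesAt (0 : Site 2))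
      ≤ (bondPercolation (zdGraph 3) p).real (⋃ x ∈ box 3 (K * n), percolatesAt x) := by
    refine measureReal_mono (fun ω hω => ?_) (measure_ne_top _ _)
    obtain ⟨x, hx, hinf⟩ := stub_denseGlue K s m hm ω hω
    exact Set.mem_iUnion₂.2 ⟨x, hx, hinf⟩
  have hpos : 0 < (bondPercolation (zdGraph 3) p).real (⋃ x ∈ box 3 (K * n), percolatesAt x) :=
    hperc.trans_le hle
  -- (3) union bound over the finite box and translation invariance θ_x = θ_0
  have hub : (bondPercolation (zdGraph 3) p).real (⋃ x ∈ box 3 (K * n), percolatesAt x) ≤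
      ∑ x ∈ box 3 (K * n), (bondPercolation (zdGraph 3) p).real (percolatesAt x) :=
    measureReal_biUnion_finset_le _ _
  have hsum : ∑ x ∈ box 3 (K * n), (bondPercolation (zdGraph 3) p).real (percolatesAt x) =
      ((box 3 (K * n)).card : ℝ) * theta (zdGraph 3) 0 p := by
    have hx : ∀ x ∈ box 3 (K * n),
        (bondPercolation (zdGraph 3) p).real (percolatesAt x) = theta (zdGraph 3) 0 p :=
      fun x _ => theta_zdGraph_eq_theta_zero p x
    rw [Finset.sum_congr rfl hx, Finset.sum_const, nsmul_eq_mul]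
  by_contra hθ
  have hθ0 : theta (zdGraph 3) 0 p = 0 := le_antisymm (not_lt.1 hθ) measureReal_nonneg
  rw [hθ0, mul_zero] at hsum
  linarith

/-- **No dense blocks at criticality** (the unconditional output of the criterion at `p_c`): with the `δ`
of `denseCriterion K`, `P_{p_c}(denseBox K s m) ≤ 1 − δ` for all `s` and `m ≥ 1` (continuity of the box
polynomial + `θ ≡ 0` below `p_c`; port of `stub_noGoodBoxAtPc`, p152405). -/
theorem real_denseBox_criticalProbI_le (K : ℕ) (hK : 2 ≤ K) :
    ∃ δ : ℝ, 0 < δ ∧ ∀ s m : ℕ, 1 ≤ m →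
      (bondPercolation (zdGraph 3) (criticalProbI 3)).real (denseBox K s m) ≤ 1 - δ := by
  obtain ⟨δ, hδ, hcrit⟩ := denseCriterion K hK
  refine ⟨δ, hδ, fun s m hm => ?_⟩
  by_contra hgt
  have hgood : 1 - δ < (bondPercolation (zdGraph 3) (criticalProbI 3)).real (denseBox K s m) :=
    not_le.1 hgt
  have h0lt : (0 : unitInterval) < criticalProbI 3 := by
    show (0 : ℝ) < criticalProb (zdGraph 3) (0 : Site 3)
    exact criticalProb_zd_pos 3 (by norm_num)
  obtain ⟨q, hqp, hq⟩ :=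
    exists_lt_of_continuous_unitInterval (continuous_real_denseBox hK hm) h0lt hgood
  have hθq : 0 < theta (zdGraph 3) 0 q := hcrit q s m hm hq
  have hq0 : theta (zdGraph 3) (0 : Site 3) q = 0 :=
    theta_eq_zero_of_lt_criticalProb_holds (zdGraph 3) (0 : Site 3) q hqp
  exact absurd hq0 (ne_of_gt hθq)

/-- **No linear-scale finite-box LRO at `p_c`** from the stubs: `K = 0` is vacuous (`e₀ ∉ Λ(0)`),
`K = 1` is Stub B, and for `K ≥ 2` Stub D produces, for the `δ`-schedule of `denseCriterion`, a dense
block with `P_{p_c} > 1 − δ K'`, contradicting `real_denseBox_criticalProbI_le`. -/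
theorem not_linearLRO_criticalProbI_of_critDense
    (hD : (∀ (ρ : ℝ) (K : ℕ), 0 < ρ → 2 ≤ K →
      (∀ n : ℕ, 1 ≤ n → ∀ x ∈ box 3 n, ∀ y ∈ box 3 n,
        ρ ≤ (bondPercolation (zdGraph 3) (criticalProbI 3)).real (openConnIn ↑(box 3 (K * n)) x y)) →
      ∀ δ : ℕ → ℝ, (∀ K', 0 < δ K') →
        ∃ K' s m : ℕ, 2 ≤ K' ∧ 1 ≤ m ∧
          1 - δ K' < (bondPercolation (zdGraph 3) (criticalProbI 3)).real (denseBox K' s m))) :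
    ¬ (∃ ρ : ℝ, 0 < ρ ∧ ∃ K : ℕ, ∀ n : ℕ, 1 ≤ n → ∀ x ∈ box 3 n, ∀ y ∈ box 3 n,
        ρ ≤ (bondPercolation (zdGraph 3) (criticalProbI 3)).real (openConnIn ↑(box 3 (K * n)) x y)) := by
  rintro ⟨ρ, hρ, K, hK⟩
  by_cases hK2 : 2 ≤ K
  · -- the δ-schedule of the criterion
    have hsched : ∀ K' : ℕ, ∃ δ : ℝ, 0 < δ ∧ (2 ≤ K' → ∀ s m : ℕ, 1 ≤ m →
        (bondPercolation (zdGraph 3) (criticalProbI 3)).real (denseBox K' s m) ≤ 1 - δ) := by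
      intro K'
      by_cases h2 : 2 ≤ K'
      · obtain ⟨δ, hδ, h⟩ := real_denseBox_criticalProbI_le K' h2
        exact ⟨δ, hδ, fun _ => h⟩
      · exact ⟨1, one_pos, fun h => absurd h h2⟩
    choose δ hδ hle using hsched
    obtain ⟨K', s, m, hK', hm, hgt⟩ := hD ρ K hρ hK2 hK δ hδ
    exact absurd (hle K' hK' s m hm) (not_le.2 hgt)
  · interval_cases K
    · -- K = 0: `0 ↔ e₀ inside Λ(0) = {0}` is impossible
      have h1 : (Pi.single 0 1 : Site 3) ∈ box 3 1 := by
        rw [mem_box]; intro i; by_cases hi : i = 0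
        · subst hi; simp
        · simp [Pi.single_eq_of_ne hi]
      have h := hK 1 le_rfl 0 (zero_mem_box 3 1) (Pi.single 0 1) h1
      have hempty : (openConnIn (↑(box 3 (0 * 1)) : Set (Site 3)) (0 : Site 3) (Pi.single 0 1) :
          Set (BondConfig (Site 3))) = ∅ := by
        ext ω
        simp only [Set.mem_empty_iff_false, iff_false]
        rintro ⟨-, hy, -⟩
        rw [zero_mul, Finset.mem_coe, mem_box] at hy
        have := hy 0
        simp at this
      rw [hempty, measureReal_empty] at h
      exact absurd h (not_le.2 hρ)
    · exact stub_noLRO_K1 ⟨ρ, hρ, hK⟩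

/-- **The near-maximal regime of Stub D, PROVED**: for every `K ≥ 2` there is `η₀ > 0` such that
linear-scale finite-box LRO at `p_c` with constants `(ρ, K)` is impossible once `ρ ≥ (1 − η₀)·θ(p_c)²`.
(Recall `LRO_lin(p) ⇒ ρ ≤ θ(p)`, and in fact `ρ ≤ θ(p)²` since far-apart points are joined only if both
are locally large; so this is the regime where in-box connectivity nearly saturates its ceiling.)  Proof:
`θ := θ(p_c) ≥ ρ > 0`; `θ_s ↓ θ` gives a local scale `s` with `(1 − 2η₀) θ_s² ≤ (1 − η₀) θ² ≤ ρ`, so the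
pair-sum hypothesis of Stub M2 holds with `η = 2η₀` at every grid size `m`; Stub M2 bounds
`P_{p_c}(not dense) ≤ 96 η₀ + 200/(θ² m³) < δ(K)` for `η₀ = δ/200` and `m` large, contradicting
`real_denseBox_criticalProbI_le`. -/
theorem not_nearMaximal_linearLRO_criticalProbI (K : ℕ) (hK : 2 ≤ K) :
    ∃ η₀ : ℝ, 0 < η₀ ∧ ∀ ρ : ℝ, 0 < ρ →
      (1 - η₀) * theta (zdGraph 3) 0 (criticalProbI 3) ^ 2 ≤ ρ →
      ¬ (∀ n : ℕ, 1 ≤ n → ∀ x ∈ box 3 n, ∀ y ∈ box 3 n,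
          ρ ≤ (bondPercolation (zdGraph 3) (criticalProbI 3)).real (openConnIn ↑(box 3 (K * n)) x y)) := by
  obtain ⟨δ, hδ, hle⟩ := real_denseBox_criticalProbI_le K hK
  refine ⟨δ / 200, by positivity, ?_⟩
  intro ρ hρ hnear hLRO
  set P := bondPercolation (zdGraph 3) (criticalProbI 3) with hP
  set θ : ℝ := theta (zdGraph 3) 0 (criticalProbI 3) with hθdef
  have hθρ : ρ ≤ θ := le_theta_of_linearLRO (criticalProbI 3) hLRO
  have hθ : 0 < θ := hρ.trans_le hθρ
  -- a local scale `s` with `(1 - 2η₀) θ_s² ≤ (1 - η₀) θ²`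
  set η₀ : ℝ := δ / 200 with hη₀
  have hη₀1 : η₀ < 1 / 4 := by
    have : δ ≤ 1 := by
      have h := hle 0 1 le_rfl
      linarith [measureReal_nonneg (μ := P) (s := denseBox K 0 1)]
    rw [hη₀]; linarith
  have hlim := tendsto_real_siteToBoundary (d := 3) (criticalProbI 3)
  have htarget : (1 - 2 * η₀) * θ ^ 2 < (1 - η₀) * θ ^ 2 := by
    have h1 : (1 - η₀) * θ ^ 2 - (1 - 2 * η₀) * θ ^ 2 = η₀ * θ ^ 2 := by ring
    have h2 : 0 < η₀ * θ ^ 2 := by positivity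
    linarith
  -- `θ_s² → θ²`, so eventually `(1 - 2η₀) θ_s² < (1 - η₀) θ²`... we use `θ_s → θ` and continuity of squaring
  have hlim2 : Tendsto (fun s : ℕ => (1 - 2 * η₀) * (P.real (siteToBoundary 3 s)) ^ 2) atTop
      (𝓝 ((1 - 2 * η₀) * θ ^ 2)) :=
    ((hlim.pow 2).const_mul (1 - 2 * η₀))
  obtain ⟨s, hs⟩ := (hlim2.eventually (gt_mem_nhds htarget)).exists
  set θs : ℝ := P.real (siteToBoundary 3 s) with hθs
  have hθs_ge : θ ≤ θs := DCT16.theta_le_real_siteToBoundary (criticalProbI 3) s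
  have hθs_pos : 0 < θs := hθ.trans_le hθs_ge
  -- the pair-sum hypothesis of Stub M2 with η = 2η₀, at every grid size m
  have hpairs : ∀ m : ℕ, 1 ≤ m →
      (1 - 2 * η₀) * θs ^ 2 * ((coreGrid s m).card : ℝ) ^ 2 ≤
        ∑ y ∈ coreGrid s m, ∑ y' ∈ coreGrid s m,
          P.real (openConnIn ↑(box 3 (K * ((2 * s + 1) * m))) y y') := by
    intro m hm
    have hn1 : 1 ≤ (2 * s + 1) * m := Nat.mul_pos (Nat.succ_pos _) hm
    have hterm : ∀ y ∈ coreGrid s m, ∀ y' ∈ coreGrid s m,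
        (1 - 2 * η₀) * θs ^ 2 ≤ P.real (openConnIn ↑(box 3 (K * ((2 * s + 1) * m))) y y') := by
      intro y hy y' hy'
      have h := hLRO ((2 * s + 1) * m) hn1 y (coreGrid_subset_box s m hy) y' (coreGrid_subset_box s m hy')
      linarith [hs.le]
    calc (1 - 2 * η₀) * θs ^ 2 * ((coreGrid s m).card : ℝ) ^ 2
        = ∑ _y ∈ coreGrid s m, ∑ _y' ∈ coreGrid s m, (1 - 2 * η₀) * θs ^ 2 := by
          rw [Finset.sum_const, Finset.sum_const, nsmul_eq_mul, nsmul_eq_mul]; ring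
      _ ≤ _ := Finset.sum_le_sum fun y hy => Finset.sum_le_sum fun y' hy' => hterm y hy y' hy'
  -- a grid size m with 200/(θs² m³) < δ/2
  obtain ⟨m, hm1, hm⟩ : ∃ m : ℕ, 1 ≤ m ∧ 200 / (θs ^ 2 * (m : ℝ) ^ 3) < δ / 2 := by
    have ht : Tendsto (fun m : ℕ => 200 / (θs ^ 2 * (m : ℝ) ^ 3)) atTop (𝓝 0) := by
      have h3 : Tendsto (fun m : ℕ => θs ^ 2 * (m : ℝ) ^ 3) atTop atTop :=
        Tendsto.const_mul_atTop (by positivity)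
          ((tendsto_pow_atTop (by norm_num : (3 : ℕ) ≠ 0)).comp (tendsto_natCast_atTop_atTop (R := ℝ)))
      exact tendsto_const_nhds.div_atTop h3
    obtain ⟨m, hm⟩ := ((ht.eventually (gt_mem_nhds (half_pos hδ))).and (eventually_ge_atTop 1)).exists
    exact ⟨m, hm.2, hm.1⟩
  -- Stub M2 at p_c
  have hMarkov := stub_denseMarkov (criticalProbI 3) K s m (2 * η₀) (by omega) hm1 hθs_pos (hpairs m hm1)
  have hθs_le : 200 / (θs ^ 2 * (m : ℝ) ^ 3) ≤ 200 / (θs ^ 2 * (m : ℝ) ^ 3) := le_rfl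
  have hcompl : P.real (denseBox K s m)ᶜ < δ := by
    have : 48 * (2 * η₀) + 200 / (θs ^ 2 * (m : ℝ) ^ 3) < δ := by
      rw [hη₀]; linarith
    exact hMarkov.trans_lt this
  have hmeas : MeasurableSet (denseBox K s m) := measurableSet_denseBox hK hm1
  have hdense : 1 - δ < P.real (denseBox K s m) := by
    have h1 : P.real (denseBox K s m) + P.real (denseBox K s m)ᶜ = 1 := by
      rw [measureReal_add_measureReal_compl hmeas, probReal_univ]
    linarith
  exact absurd (hle s m hm1) (not_le.2 hdense)

/-! ## The LRO constant is at most `θ(p)²` -/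

/-- **The LRO constant is at most `θ_s(p)²`.**  If `ρ ≤ P_p(x ↔ y inside Λ(Kn))` for all `n ≥ 1` and
`x, y ∈ Λ(n)`, then `ρ ≤ P_p(0 ↔ ∂Λ(s))²` for every `s`: the pair `0`, `(2s+1)e₀` of `Λ(2s+1)` is joined only if
both points are locally large at scale `s` (first exit of the joining path), two events determined by the
disjoint boxes `Λ(s)` and `(2s+1)e₀ + Λ(s)`, hence independent. -/
theorem lro_le_real_siteToBoundary_sq (p : unitInterval) {ρ : ℝ} {K : ℕ}
    (h : ∀ n : ℕ, 1 ≤ n → ∀ x ∈ box 3 n, ∀ y ∈ box 3 n,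
      ρ ≤ (bondPercolation (zdGraph 3) p).real (openConnIn ↑(box 3 (K * n)) x y)) (s : ℕ) :
    ρ ≤ (bondPercolation (zdGraph 3) p).real (siteToBoundary 3 s) ^ 2 := by
  have h1 : (Pi.single 0 1 : Site 3) ∈ box 3 1 := by
    rw [mem_box]; intro i
    by_cases hi : i = 0
    · subst hi; simp
    · simp [Pi.single_eq_of_ne hi]
  set y : Site 3 := gridPt s (Pi.single 0 1) with hy
  have hy1 : y ∈ coreGrid s 1 := mem_coreGrid.2 ⟨Pi.single 0 1, h1, rfl⟩
  have h01 : (0 : Site 3) ∈ coreGrid s 1 :=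
    mem_coreGrid.2 ⟨0, zero_mem_box 3 1, by funext i; simp [gridPt_apply]⟩
  have hg0 : gridPt s (0 : Site 3) = 0 := by funext i; simp [gridPt_apply]
  have hne : (0 : Site 3) ≠ y := by
    intro h0
    have := congrFun h0 0
    simp [hy, gridPt_apply] at this
    omega
  have hyb : y ∈ box 3 (2 * s + 1) := by simpa using coreGrid_subset_box s 1 hy1
  have hρ := h (2 * s + 1) (by omega) 0 (zero_mem_box 3 _) y hyb
  have hincl : (bondPercolation (zdGraph 3) p).real (openConnIn ↑(box 3 (K * (2 * s + 1))) 0 y) ≤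
      (bondPercolation (zdGraph 3) p).real (DCT16.armEvent 0 s ∩ DCT16.armEvent y s) :=
    DCT16.real_mono_of_forall_subset_edgeSet (zdGraph 3) p fun ω hω hc =>
      ⟨markov_armEvent_of_openConnIn hω h01 hy1 hne hc,
        markov_armEvent_of_openConnIn hω hy1 h01 hne.symm (openConnIn_reverse hc)⟩
  have hfar : ∃ i : Fin 3, ((2 * s + 1 : ℕ) : ℤ) ≤ |(0 : Site 3) i - y i| := by
    have := exists_le_abs_sub_of_ne (s := s) (z := 0) (z' := Pi.single 0 1)
      (by intro h0; exact hne (by rw [hy, ← h0, hg0]))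
    rw [hg0] at this
    simpa only [hy, Pi.zero_apply] using this
  rw [← armEvent_real_inter p hfar]
  exact hρ.trans hincl

/-- **The LRO constant is at most `θ(p)²`** (`θ_s ↓ θ`).  So the near-maximal regime `ρ ≥ (1 − η₀)θ(p_c)²` of the
crux is the regime where in-box connectivity nearly saturates its ceiling. -/
theorem lro_le_theta_sq (p : unitInterval) {ρ : ℝ} {K : ℕ}
    (h : ∀ n : ℕ, 1 ≤ n → ∀ x ∈ box 3 n, ∀ y ∈ box 3 n,
      ρ ≤ (bondPercolation (zdGraph 3) p).real (openConnIn ↑(box 3 (K * n)) x y)) :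
    ρ ≤ theta (zdGraph 3) 0 p ^ 2 :=
  ge_of_tendsto ((tendsto_real_siteToBoundary (d := 3) p).pow 2)
    (Eventually.of_forall fun s => lro_le_real_siteToBoundary_sq p h s)

/-- **The crux from the one open statement of the line** (`stub_critDense`): with the dense-block route for
`K ≥ 2`, Barsky–Grimmett–Newman for `K = 1` and the anatomy `R ⇔ ¬LRO_lin(p_c)` (p152652). -/
theorem renormaliseFromLinearLRO_of_critDense
    (hD : (∀ (ρ : ℝ) (K : ℕ), 0 < ρ → 2 ≤ K →
      (∀ n : ℕ, 1 ≤ n → ∀ x ∈ box 3 n, ∀ y ∈ box 3 n,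
        ρ ≤ (bondPercolation (zdGraph 3) (criticalProbI 3)).real (openConnIn ↑(box 3 (K * n)) x y)) →
      ∀ δ : ℕ → ℝ, (∀ K', 0 < δ K') →
        ∃ K' s m : ℕ, 2 ≤ K' ∧ 1 ≤ m ∧
          1 - δ K' < (bondPercolation (zdGraph 3) (criticalProbI 3)).real (denseBox K' s m))) :
    Summit.CriticalPhenomena.PercolationContinuityZ3.Theses.PercFiniteBoxLRO.RenormaliseFromLinearLRO :=
  renormaliseFromLinearLRO_of_not_linearLRO_criticalProbI (not_linearLRO_criticalProbI_of_critDense hD)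

/-! ## Registered sub-goals of the item (closed here) -/

/-- **Registered sub-goal `stub_noDenseBoxAtPc` of crux stmt-CriticalPhenomena-0857**: no dense blocks at
criticality — for every `K ≥ 2` there is `δ > 0` with `P_{p_c(ℤ³)}(denseBox K s m) ≤ 1 − δ` for all `s` and
`m ≥ 1`.  Unconditional.  Definitionally `real_denseBox_criticalProbI_le`. -/
theorem stub_noDenseBoxAtPc :
    ∀ K : ℕ, 2 ≤ K → ∃ δ : ℝ, 0 < δ ∧ ∀ s m : ℕ, 1 ≤ m →
      (bondPercolation (zdGraph 3) (criticalProbI 3)).real (denseBox K s m) ≤ 1 - δ :=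
  real_denseBox_criticalProbI_le

/-- **Registered sub-goal `stub_noNearMaximalLRO` of crux stmt-CriticalPhenomena-0857 — the near-maximal regime
of the crux, settled**: for every `K ≥ 2` there is `η₀ > 0` such that no `ρ > 0` with `(1 − η₀)·θ(p_c)² ≤ ρ`
satisfies `ρ ≤ P_{p_c}(x ↔ y inside Λ(Kn))` for all `n ≥ 1`, `x, y ∈ Λ(n)`.  Unconditional.  Definitionally
`not_nearMaximal_linearLRO_criticalProbI`. -/
theorem stub_noNearMaximalLRO :
    ∀ K : ℕ, 2 ≤ K → ∃ η₀ : ℝ, 0 < η₀ ∧ ∀ ρ : ℝ, 0 < ρ →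
      (1 - η₀) * theta (zdGraph 3) 0 (criticalProbI 3) ^ 2 ≤ ρ →
      ¬ (∀ n : ℕ, 1 ≤ n → ∀ x ∈ box 3 n, ∀ y ∈ box 3 n,
          ρ ≤ (bondPercolation (zdGraph 3) (criticalProbI 3)).real (openConnIn ↑(box 3 (K * n)) x y)) :=
  not_nearMaximal_linearLRO_criticalProbI

end Summit.CriticalPhenomena.PercolationContinuityZ3.Theorems.RenormaliseFromLinearLRO

end
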